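import Mathlib

/-!
# Order of the image of an element in a quotient of a finite cyclic group

Solo side programme O1b (Eisenstein modulus law at level `2N`): the level-raised factor of the
`2`-new Eisenstein modulus is the index `[G : ⟨Frob₂⟩]`, where `G = (ℤ/N)ˣ / μ_g` is the covering
group of the Shimura covering `X₂(N) → X₀(N)` (`g = gcd(N − 1, 12)`).  Its closed form
`[G : ⟨2⟩] = (N − 1)·gcd(ord_N 2, g) / (g · ord_N 2)` rests on the following fact about finite
cyclic groups: the image of `x` in `G ⧸ K` has order `ord(x) / gcd(ord(x), |K|)`, because a
subgroup of a finite cyclic group is determined by its order.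
-/

set_option linter.dupNamespace false

namespace Summit.Langlands.Langlands.Theorems.SoloBlindCyclicQuotientOrder

variable {G : Type*} [CommGroup G] [Finite G]

/-- In a finite cyclic group a subgroup is determined by its order: `x ∈ K ↔ ord(x) ∣ |K|`. -/
theorem mem_iff_orderOf_dvd_card [IsCyclic G] (K : Subgroup G) (x : G) :
    x ∈ K ↔ orderOf x ∣ Nat.card K := by
  classical
  refine ⟨fun hx => K.orderOf_dvd_natCard hx, fun hx => ?_⟩
  haveI : Fintype G := Fintype.ofFinite G
  set n := Nat.card K with hn
  have hnpos : 0 < n := Nat.card_pos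
  set S : Finset G := Finset.univ.filter fun a : G => a ^ n = 1 with hS
  have hSle : S.card ≤ n := IsCyclic.card_pow_eq_one_le hnpos
  have hKS : (K : Set G).toFinset ⊆ S := by
    intro a ha
    rw [Set.mem_toFinset, SetLike.mem_coe] at ha
    rw [hS, Finset.mem_filter]
    refine ⟨Finset.mem_univ _, ?_⟩
    have h := pow_card_eq_one' (G := K) (x := ⟨a, ha⟩)
    rw [← hn] at h
    have h' := congrArg Subtype.val h
    simpa using h'
  have hKcard : (K : Set G).toFinset.card = n := by
    rw [hn, ← Nat.card_eq_card_toFinset]; rfl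
  have hEq : (K : Set G).toFinset = S :=
    Finset.eq_of_subset_of_card_le hKS (by rw [hKcard]; exact hSle)
  have hxS : x ∈ S := by
    rw [hS, Finset.mem_filter]
    exact ⟨Finset.mem_univ _, orderOf_dvd_iff_pow_eq_one.1 hx⟩
  rw [← hEq, Set.mem_toFinset] at hxS
  exact hxS

/-- `x ^ n ∈ K ↔ ord(x) / gcd(ord(x), n) ∣ |K|` in a finite cyclic group. -/
theorem pow_mem_iff_div_gcd_dvd_card [IsCyclic G] (K : Subgroup G) (x : G) (n : ℕ) :
    x ^ n ∈ K ↔ orderOf x / Nat.gcd (orderOf x) n ∣ Nat.card K := by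
  rw [mem_iff_orderOf_dvd_card, orderOf_pow]

/-- **Order in the quotient.**  In a finite cyclic group, the image of `x` in `G ⧸ K` has order
`ord(x) / gcd(ord(x), |K|)`. -/
theorem orderOf_mk_eq [IsCyclic G] (K : Subgroup G) (x : G) :
    orderOf (x : G ⧸ K) = orderOf x / Nat.gcd (orderOf x) (Nat.card K) := by
  set o := orderOf x with ho
  set k := Nat.card K with hk
  have hopos : 0 < o := orderOf_pos x
  have key : ∀ n : ℕ, (x : G ⧸ K) ^ n = 1 ↔ o / Nat.gcd o n ∣ k := by
    intro n
    rw [← QuotientGroup.mk_pow, QuotientGroup.eq_one_iff, pow_mem_iff_div_gcd_dvd_card]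
  apply Nat.dvd_antisymm
  · apply orderOf_dvd_of_pow_eq_one
    rw [key]
    have hm : o / Nat.gcd o k ∣ o := Nat.div_dvd_of_dvd (Nat.gcd_dvd_left o k)
    rw [Nat.gcd_eq_right hm, Nat.div_div_self (Nat.gcd_dvd_left o k) hopos.ne']
    exact Nat.gcd_dvd_right o k
  · set n := orderOf (x : G ⧸ K) with hn
    have h1 : o / Nat.gcd o n ∣ k := (key n).1 (pow_orderOf_eq_one _)
    have h2 : o / Nat.gcd o n ∣ o := Nat.div_dvd_of_dvd (Nat.gcd_dvd_left o n)
    have h3 : o / Nat.gcd o n ∣ Nat.gcd o k := Nat.dvd_gcd h2 h1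
    have h4 : o ∣ Nat.gcd o k * Nat.gcd o n := by
      have := Nat.mul_dvd_mul_right h3 (Nat.gcd o n)
      rwa [Nat.div_mul_cancel (Nat.gcd_dvd_left o n)] at this
    have h5 : o / Nat.gcd o k ∣ Nat.gcd o n := by
      have e : o / Nat.gcd o k * Nat.gcd o k = o := Nat.div_mul_cancel (Nat.gcd_dvd_left o k)
      have h4' : o / Nat.gcd o k * Nat.gcd o k ∣ Nat.gcd o n * Nat.gcd o k := by
        rw [e, mul_comm]; exact h4
      exact Nat.dvd_of_mul_dvd_mul_right (Nat.gcd_pos_of_pos_left k hopos) h4'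
    exact h5.trans (Nat.gcd_dvd_right o n)

/-- Multiplicative form: `ord(x̄) · gcd(ord(x), |K|) = ord(x)`. -/
theorem orderOf_mk_mul_gcd [IsCyclic G] (K : Subgroup G) (x : G) :
    orderOf (x : G ⧸ K) * Nat.gcd (orderOf x) (Nat.card K) = orderOf x := by
  rw [orderOf_mk_eq, Nat.div_mul_cancel (Nat.gcd_dvd_left _ _)]

/-- Index form: `[G ⧸ K : ⟨x̄⟩] · ord(x) = |G ⧸ K| · gcd(ord(x), |K|)`, i.e. for `G` cyclic of
order `M` and `|K| = g`: `[G/K : ⟨x̄⟩] = M · gcd(ord x, g) / (g · ord x)`. -/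
theorem index_zpowers_mk_mul_orderOf [IsCyclic G] (K : Subgroup G) (x : G) :
    (Subgroup.zpowers (x : G ⧸ K)).index * orderOf x
      = Nat.card (G ⧸ K) * Nat.gcd (orderOf x) (Nat.card K) := by
  have h := (Subgroup.zpowers (x : G ⧸ K)).index_mul_card
  rw [Nat.card_zpowers] at h
  calc (Subgroup.zpowers (x : G ⧸ K)).index * orderOf x
      = (Subgroup.zpowers (x : G ⧸ K)).index * (orderOf (x : G ⧸ K)
          * Nat.gcd (orderOf x) (Nat.card K)) := by rw [orderOf_mk_mul_gcd]
    _ = ((Subgroup.zpowers (x : G ⧸ K)).index * orderOf (x : G ⧸ K))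
          * Nat.gcd (orderOf x) (Nat.card K) := by ring
    _ = Nat.card (G ⧸ K) * Nat.gcd (orderOf x) (Nat.card K) := by rw [h]

end Summit.Langlands.Langlands.Theorems.SoloBlindCyclicQuotientOrder
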